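import Summits.Ventures.YMGap.RobustBall.EnergyVarianceTorusBall
import Summits.Ventures.YMGap.RobustBall.MemberPressure
import Summits.Ventures.YMGap.RobustBall.HaarSecondMoments
import Literature.Probability.LatticeModels.ZModTorusFrames
import HarnessLib

/-!
# Venture YMGap, track ROBUST-BALL (Y2) — THE FINITE-VOLUME FREE ENERGY IS STRONGLY CONVEX IN THE COUPLING, UNIFORMLY ON THE
# TIER-1 TORUS BALL AND IN THE VOLUME; so is every thermodynamic limit of member free energies

HONEST FRAMING. WHAT THIS IS: a venture file (cell `pub-ymgap`, track Y2 ROBUST-BALL, seat rb-p2, theorems only, 0 compute).  LATTICE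
statements, valid at EVERY coupling, about the torus pressures `p_{L,W}(t) = L^{−d} log Z_{Λ_L,t,W}`, `Z_{Λ,t,W} = ∫ e^{−t S_W − W} ∏ dU`, of
the MEMBERS `W` of rb-theory's tier-1 torus ball `ClusterDomainFR ε₀ ε₁ r` (`RobustBall/Defs.lean`; finite range `r`, oscillation load
`≤ ε₀`; `ε₁` unused), `G = SU(N)`, `N ≥ 2`, `d ≥ 2`.  With `k = max r 1 + 1` and `V₀ = charVariance ρ`:
* `exists_sparse_grid` — for `k ≥ 1` the torus `(ℤ/L)^d` contains `⌊L/k⌋^d` sites pairwise at periodic sup-distance `≥ k`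
  (the grid `k · {0, …, ⌊L/k⌋−1}^d`); `grid_density_ge` — `⌊L/k⌋^d / L^d ≥ (2k)^{−d}`.
* ★★ `ball_floor_le_variance_wilsonAction` — FINITE-VOLUME SPECIFIC-HEAT FLOOR ON THE BALL: every `L ≥ k`, every member `W`, every real
  `β`: `Var_{μ_{Λ_L,β,W}}(S_W) ≥ ⌊L/k⌋^d · e^{−(8(d−1)N|β| + 2ε₀)} · V₀` (`EnergyVarianceTorusBall` on the grid).
* (the pressure as a cumulant generating function, `log Z_{Λ,t,W} = cgf_{ν_W}(−S_W)(t) + log Z_{Λ,0,W}`, `ν_W ∝ e^{−W} ∏ dU`, is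
  `MemberPressure.log_partitionFunction_eq_cgf_add`.)
* ★★★ `strongConvexOn_memberPressure` — for EVERY `L ≥ k`, EVERY member `W ∈ ClusterDomainFR ε₀ ε₁ r` and every `b`:
  `StrongConvexOn [−b, b] ((2k)^{−d} · e^{−(8(d−1)N b + 2ε₀)} · V₀) (t ↦ L^{−d} log Z_{Λ_L,t,W})` — ONE modulus for the whole ball and
  all volumes (the Wilson member `W = 0` is `FreeEnergyStrongConvexity`, modulus `(1/2)V₀e^{−8(d−1)Nb}` there by the checkerboard set).
* ★★ `strongConvexOn_of_tendsto_memberPressure` — consequently every pointwise limit `f` on `[−b, b]` of member pressures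
  `p_{L_n, W_n}` (`L_n ≥ k`, `W_n ∈ ClusterDomainFR ε₀ ε₁ r` on the torus of side `L_n`) is strongly convex with the same modulus: whenever a
  thermodynamic limit of member free energies exists (along any volumes, for any members), it is strongly convex in the coupling — the
  uniform-on-the-ball form of rb-p2 g8's `strongConvexOn_freeEnergyDensity`.
* `su2_strongConvexOn_memberPressure_dim4` — `SU(2)`, `d = 4`, tree coupling `β = β_W/2`: modulus `e^{−(48 b + 2ε₀)}/(2k)^4`;
  `suN_strongConvexOn_memberPressure` — every `SU(N)`, `N ≥ 3` (`V₀ = 1/2`).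
WHAT THIS IS NOT: no existence claim for the thermodynamic limit of a member's free energy (the tree proves it for the Wilson member only);
no statement at large `β` uniform in `β` (the modulus decays like `e^{−8(d−1)Nb}`); nothing about the continuum limit or a Clay-sense mass gap.

References: B. Simon, *The Statistical Mechanics of Lattice Gases* I (1993), §II.1 (pressure = cumulant generating function, `p'' =`
variance density); H.-O. Georgii (2011), Remark 1.24.  Everything here is proved; no definition, no named fact. [folklore]
-/

noncomputable section

open MeasureTheory ProbabilityTheory Finset Function Filter Topology
open Literature.MathematicalPhysics.QuantumLattice hiding torusNorm
open Literature.MathematicalPhysics.QuantumFieldTheory hiding ZdEdge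

namespace Summit.Ventures.YMGap.RobustBall

namespace EnergyVariance

/-! ### Part A — a sparse grid of the discrete torus -/

section Grid

variable {d L : ℕ}

/-- Cyclic distance between two multiples of `k` below `k · q ≤ L`: at least `k`. [folklore] -/
theorem le_natAbs_valMinAbs_mul_sub_mul {k q a a' : ℕ} (hk : 1 ≤ k) (hkq : k * q ≤ L) (ha : a < q) (h : a' < a) :
    k ≤ ((((k * a : ℕ) : ZMod L) - ((k * a' : ℕ) : ZMod L)).valMinAbs).natAbs := by
  have h1 : k * a' + k ≤ k * a := by
    have : k * (a' + 1) ≤ k * a := Nat.mul_le_mul_left k h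
    linarith
  have h2 : k * a + k ≤ k * q := by
    have : k * (a + 1) ≤ k * q := Nat.mul_le_mul_left k ha
    linarith
  have hu : k * a < L := by omega
  rw [Literature.Probability.LatticeModels.natAbs_valMinAbs_natCast_sub hu (by omega)]
  exact le_min (by omega) (by omega)

/-- **A sparse grid.**  For `k ≥ 1` the torus `(ℤ/L)^d` contains a set of `⌊L/k⌋^d` sites pairwise at periodic sup-distance `≥ k`
(the sites `k · a`, `a ∈ {0, …, ⌊L/k⌋ − 1}^d`). [folklore] -/
theorem exists_sparse_grid [NeZero L] {k : ℕ} (hk : 1 ≤ k) :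
    ∃ S : Finset (Site d L), S.card = (L / k) ^ d ∧ ∀ x ∈ S, ∀ x' ∈ S, x ≠ x' → k ≤ torusNorm (x - x') := by
  classical
  have hkq : k * (L / k) ≤ L := by rw [mul_comm]; exact Nat.div_mul_le_self L k
  set g : (Fin d → Fin (L / k)) → Site d L := fun a i => ((k * (a i : ℕ) : ℕ) : ZMod L) with hg
  have hlt : ∀ (a : Fin d → Fin (L / k)) (i : Fin d), k * (a i : ℕ) < L := fun a i => by
    have h2 : k * ((a i : ℕ) + 1) ≤ k * (L / k) := Nat.mul_le_mul_left k (a i).isLt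
    linarith
  have hval : ∀ (a : Fin d → Fin (L / k)) (i : Fin d), (g a i).val = k * (a i : ℕ) := fun a i =>
    ZMod.val_natCast_of_lt (hlt a i)
  have hinj : Function.Injective g := by
    intro a a' h
    funext i
    have hi : (g a i).val = (g a' i).val := by rw [h]
    rw [hval, hval] at hi
    exact Fin.ext (Nat.eq_of_mul_eq_mul_left (by omega) hi)
  refine ⟨Finset.univ.image g, ?_, fun x hx x' hx' hne => ?_⟩
  · rw [Finset.card_image_of_injective _ hinj, Finset.card_univ, Fintype.card_fun, Fintype.card_fin, Fintype.card_fin]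
  · obtain ⟨a, -, rfl⟩ := Finset.mem_image.1 hx
    obtain ⟨a', -, rfl⟩ := Finset.mem_image.1 hx'
    have hne' : a ≠ a' := fun h => hne (by rw [h])
    obtain ⟨i, hi⟩ := Function.ne_iff.1 hne'
    have hi' : (a i : ℕ) ≠ (a' i : ℕ) := fun h => hi (Fin.ext h)
    rcases lt_or_gt_of_ne hi' with hlt' | hlt'
    · rw [← torusNorm_neg, neg_sub]
      refine le_trans ?_ (natAbs_valMinAbs_le_torusNorm (g a' - g a) i)
      exact le_natAbs_valMinAbs_mul_sub_mul hk hkq (a' i).isLt hlt'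
    · refine le_trans ?_ (natAbs_valMinAbs_le_torusNorm (g a - g a') i)
      exact le_natAbs_valMinAbs_mul_sub_mul hk hkq (a i).isLt hlt'

/-- The grid has density `≥ (2k)^{−d}`: `(1/(2k))^d ≤ ⌊L/k⌋^d / L^d` for `1 ≤ k ≤ L`. [folklore] -/
theorem grid_density_ge {k : ℕ} (hk : 1 ≤ k) (hkL : k ≤ L) :
    (1 / (2 * k : ℝ)) ^ d ≤ ((L / k : ℕ) : ℝ) ^ d / (L : ℝ) ^ d := by
  have hq : 0 < L / k := Nat.div_pos hkL (by omega)
  have hlt : L < L / k * k + k := Nat.lt_div_mul_add (by omega)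
  have h2 : (L : ℝ) ≤ 2 * k * ((L / k : ℕ) : ℝ) := by
    have : L ≤ 2 * k * (L / k) := by nlinarith
    exact_mod_cast this
  have hL : (0 : ℝ) < L := by exact_mod_cast (show 0 < L by omega)
  rw [← div_pow]
  refine pow_le_pow_left₀ (by positivity) ?_ d
  rw [div_le_div_iff₀ (by positivity) hL]
  linarith

end Grid

/-! ### Part B — the finite-volume specific-heat floor on the ball -/

section Floor

variable {d L N : ℕ} [NeZero L] (ρ : SUN N →* Matrix (Fin N) (Fin N) ℂ)

/-- ★★ **FINITE-VOLUME SPECIFIC-HEAT FLOOR, UNIFORM ON THE TIER-1 TORUS BALL.**  `G = SU(N)` (`N ≥ 2`), `d ≥ 2`, `k = max r 1 + 1`: for every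
torus side `L ≥ k`, every member `W ∈ ClusterDomainFR ε₀ ε₁ r` and every real `β`,
`⌊L/k⌋^d · e^{−(8(d−1)N|β| + 2ε₀)} · V₀ ≤ ∫ (S_W − ⟨S_W⟩)² dμ_{Λ_L,β,W}`. [folklore] -/
theorem ball_floor_le_variance_wilsonAction (hρ : IsSpecialUnitaryModel ρ) (hN : 2 ≤ N) (hd : 2 ≤ d) {ε₀ ε₁ : ℝ} {r : ℕ}
    {W : Perturbation d L N} (hW : W ∈ ClusterDomainFR ε₀ ε₁ r) (hL : max r 1 + 1 ≤ L) (β : ℝ) :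
    ((L / (max r 1 + 1) : ℕ) : ℝ) ^ d * Real.exp (-(8 * (d - 1 : ℕ) * N * |β| + 2 * ε₀)) * PlaquetteLowerBound.charVariance ρ ≤
      ∫ U, (wilsonAction ρ U - ∫ V, wilsonAction ρ V ∂W.perturbedMeasure ρ β) ^ 2 ∂W.perturbedMeasure ρ β := by
  obtain ⟨S, hScard, hSsep⟩ := exists_sparse_grid (d := d) (L := L) (k := max r 1 + 1) (by omega)
  have hL1 : 1 < L := by have := le_max_right r 1; omega
  have h := card_mul_le_variance_wilsonAction_of_mem_clusterDomainFR ρ hρ hN hL1 (i := ⟨0, by omega⟩) (j := ⟨1, by omega⟩)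
    (Fin.mk_lt_mk.2 zero_lt_one) hW S (fun x hx x' hx' hne => Nat.lt_of_succ_le (hSsep x hx x' hx' hne)) β
  rw [hScard] at h
  push_cast at h
  exact h

/-- The same floor for the Mathlib variance `Var[S_W; μ_{Λ_L,β,W}]`. [folklore] -/
theorem ball_floor_le_variance_wilsonAction' (hρ : IsSpecialUnitaryModel ρ) (hN : 2 ≤ N) (hd : 2 ≤ d) {ε₀ ε₁ : ℝ} {r : ℕ}
    {W : Perturbation d L N} (hW : W ∈ ClusterDomainFR ε₀ ε₁ r) (hL : max r 1 + 1 ≤ L) (β : ℝ) :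
    ((L / (max r 1 + 1) : ℕ) : ℝ) ^ d * Real.exp (-(8 * (d - 1 : ℕ) * N * |β| + 2 * ε₀)) * PlaquetteLowerBound.charVariance ρ ≤
      Var[wilsonAction (d := d) (L := L) (G := SUN N) ρ; W.perturbedMeasure ρ β] := by
  haveI : SecondCountableTopology (Matrix (Fin N) (Fin N) ℂ) :=
    inferInstanceAs (SecondCountableTopology (Fin N → Fin N → ℂ))
  haveI : SecondCountableTopology (SUN N) := Topology.IsEmbedding.subtypeVal.secondCountableTopology
  rw [variance_eq_integral (measurable_wilsonAction ρ hρ.1).aemeasurable]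
  exact ball_floor_le_variance_wilsonAction ρ hρ hN hd hW hL β

/-! ### Part C — the member pressure as a cumulant generating function; strong convexity uniform on the ball -/

/-- The floor in the form in which the cumulant generating function is differentiated:
`⌊L/k⌋^d e^{−(8(d−1)N|t| + 2ε₀)} V₀ ≤ Var[−S_W; ν_W.tilted (t(−S_W))]`. [folklore] -/
theorem ball_floor_le_variance_tilted (hρ : IsSpecialUnitaryModel ρ) (hN : 2 ≤ N) (hd : 2 ≤ d) {ε₀ ε₁ : ℝ} {r : ℕ}
    {W : Perturbation d L N} (hW : W ∈ ClusterDomainFR ε₀ ε₁ r) (hL : max r 1 + 1 ≤ L) (t : ℝ) :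
    ((L / (max r 1 + 1) : ℕ) : ℝ) ^ d * Real.exp (-(8 * (d - 1 : ℕ) * N * |t| + 2 * ε₀)) * PlaquetteLowerBound.charVariance ρ ≤
      Var[fun U : GaugeConfig d L (SUN N) => -wilsonAction ρ U;
        ((Measure.pi fun _ : Edge d L => haarProbability (SUN N)).tilted (fun U => -W.total U)).tilted
          fun U : GaugeConfig d L (SUN N) => t * -wilsonAction ρ U] := by
  rw [tilted_tilted_eq_perturbedMeasure ρ hρ.1 W t, variance_fun_neg]
  exact ball_floor_le_variance_wilsonAction' ρ hρ hN hd hW hL t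

/-- **Strong convexity of the member pressures, finite volume (cgf form).**  For `L ≥ k = max r 1 + 1`, every member `W` and every `b`,
`t ↦ L^{−d} cgf_{ν_W}(−S_W)(t) − (m_L(b)/2) t²` is convex on `[−b, b]`, `m_L(b) = L^{−d} ⌊L/k⌋^d e^{−(8(d−1)Nb + 2ε₀)} V₀`. [folklore] -/
theorem convexOn_memberCgf_sub_sq (hρ : IsSpecialUnitaryModel ρ) (hN : 2 ≤ N) (hd : 2 ≤ d) {ε₀ ε₁ : ℝ} {r : ℕ}
    {W : Perturbation d L N} (hW : W ∈ ClusterDomainFR ε₀ ε₁ r) (hL : max r 1 + 1 ≤ L) (b : ℝ) :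
    ConvexOn ℝ (Set.Icc (-b) b) (fun t : ℝ =>
      ((L : ℝ) ^ d)⁻¹ * cgf (fun U : GaugeConfig d L (SUN N) => -wilsonAction ρ U)
          ((Measure.pi fun _ : Edge d L => haarProbability (SUN N)).tilted fun U => -W.total U) t -
        (((L : ℝ) ^ d)⁻¹ * (((L / (max r 1 + 1) : ℕ) : ℝ) ^ d * Real.exp (-(8 * (d - 1 : ℕ) * N * b + 2 * ε₀)) *
          PlaquetteLowerBound.charVariance ρ)) / 2 * t ^ 2) := by
  haveI : SecondCountableTopology (Matrix (Fin N) (Fin N) ℂ) :=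
    inferInstanceAs (SecondCountableTopology (Fin N → Fin N → ℂ))
  haveI : SecondCountableTopology (SUN N) := Topology.IsEmbedding.subtypeVal.secondCountableTopology
  haveI : IsProbabilityMeasure ((Measure.pi fun _ : Edge d L => haarProbability (SUN N)).tilted
      fun U : GaugeConfig d L (SUN N) => -W.total U) := isProbabilityMeasure_tilted (integrable_exp_neg_total W)
  have hH : Measurable fun U : GaugeConfig d L (SUN N) => -wilsonAction ρ U := (measurable_wilsonAction ρ hρ.1).neg
  obtain ⟨B, hB⟩ := exists_abs_wilsonAction_le (d := d) (L := L) ρ hρ.1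
  have hB' : ∀ U : GaugeConfig d L (SUN N), |-wilsonAction ρ U| ≤ B := fun U => by rw [abs_neg]; exact hB U
  refine convexOn_mul_cgf_sub_sq hH hB' fun t ht => ?_
  have hV : 0 < ((L : ℝ) ^ d)⁻¹ := by
    have : (0 : ℝ) < L := by exact_mod_cast (show 0 < L by have := le_max_right r 1; omega)
    positivity
  rw [Set.mem_Icc] at ht
  have habs : |t| ≤ b := abs_le.2 ⟨ht.1, ht.2⟩
  have hexp : Real.exp (-(8 * (d - 1 : ℕ) * N * b + 2 * ε₀)) ≤ Real.exp (-(8 * (d - 1 : ℕ) * N * |t| + 2 * ε₀)) :=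
    Real.exp_le_exp.2 (by nlinarith [habs, (by positivity : (0 : ℝ) ≤ 8 * (d - 1 : ℕ) * N)])
  have hfloor := ball_floor_le_variance_tilted ρ hρ hN hd hW hL t
  have hV0 := (PlaquetteLowerBound.charVariance_pos ρ hρ.1 (by omega)).le
  calc ((L : ℝ) ^ d)⁻¹ * (((L / (max r 1 + 1) : ℕ) : ℝ) ^ d * Real.exp (-(8 * (d - 1 : ℕ) * N * b + 2 * ε₀)) *
          PlaquetteLowerBound.charVariance ρ)
      ≤ ((L : ℝ) ^ d)⁻¹ * (((L / (max r 1 + 1) : ℕ) : ℝ) ^ d * Real.exp (-(8 * (d - 1 : ℕ) * N * |t| + 2 * ε₀)) *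
          PlaquetteLowerBound.charVariance ρ) := by
        gcongr
    _ ≤ _ := mul_le_mul_of_nonneg_left hfloor hV.le

/-- ★★★ **THE FINITE-VOLUME FREE ENERGY IS STRONGLY CONVEX IN THE COUPLING, UNIFORMLY ON THE TIER-1 TORUS BALL AND IN THE VOLUME.**
`G = SU(N)` (`N ≥ 2`), `d ≥ 2`, `k = max r 1 + 1`: for EVERY torus side `L ≥ k`, EVERY member `W ∈ ClusterDomainFR ε₀ ε₁ r` and every `b`,

  `StrongConvexOn [−b, b] ((2k)^{−d} · e^{−(8(d−1)N b + 2ε₀)} · V₀) (t ↦ L^{−d} log Z_{Λ_L,t,W})`,   `V₀ = charVariance ρ`,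

one modulus for the whole ball and all volumes. [folklore] -/
theorem strongConvexOn_memberPressure (hρ : IsSpecialUnitaryModel ρ) (hN : 2 ≤ N) (hd : 2 ≤ d) {ε₀ ε₁ : ℝ} {r : ℕ}
    {W : Perturbation d L N} (hW : W ∈ ClusterDomainFR ε₀ ε₁ r) (hL : max r 1 + 1 ≤ L) (b : ℝ) :
    StrongConvexOn (Set.Icc (-b) b)
      ((1 / (2 * (max r 1 + 1 : ℕ) : ℝ)) ^ d * Real.exp (-(8 * (d - 1 : ℕ) * N * b + 2 * ε₀)) * PlaquetteLowerBound.charVariance ρ)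
      (fun t : ℝ => ((L : ℝ) ^ d)⁻¹ * Real.log (W.partitionFunction ρ t).toReal) := by
  set k : ℕ := max r 1 + 1 with hk
  set K : ℝ := Real.exp (-(8 * (d - 1 : ℕ) * N * b + 2 * ε₀)) * PlaquetteLowerBound.charVariance ρ with hK
  set mL : ℝ := ((L : ℝ) ^ d)⁻¹ * (((L / k : ℕ) : ℝ) ^ d * Real.exp (-(8 * (d - 1 : ℕ) * N * b + 2 * ε₀)) *
      PlaquetteLowerBound.charVariance ρ) with hmL
  have hK0 : 0 ≤ K := mul_nonneg (Real.exp_pos _).le (PlaquetteLowerBound.charVariance_pos ρ hρ.1 (by omega)).le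
  -- the cgf form is `mL`-strongly convex
  have hcgf : StrongConvexOn (Set.Icc (-b) b) mL (fun t : ℝ =>
      ((L : ℝ) ^ d)⁻¹ * cgf (fun U : GaugeConfig d L (SUN N) => -wilsonAction ρ U)
          ((Measure.pi fun _ : Edge d L => haarProbability (SUN N)).tilted fun U => -W.total U) t) := by
    rw [strongConvexOn_real_iff]
    exact convexOn_memberCgf_sub_sq ρ hρ hN hd hW hL b
  -- adding the constant `L^{-d} log Z_0` and comparing moduli
  have hmono : (1 / (2 * k : ℝ)) ^ d * Real.exp (-(8 * (d - 1 : ℕ) * N * b + 2 * ε₀)) * PlaquetteLowerBound.charVariance ρ ≤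
      mL := by
    have hdens := grid_density_ge (d := d) (L := L) (k := k) (by omega) hL
    have e : mL = (((L / k : ℕ) : ℝ) ^ d / (L : ℝ) ^ d) * K := by
      simp only [hmL, hK]; ring
    rw [e, mul_assoc, ← hK]
    exact mul_le_mul_of_nonneg_right hdens hK0
  have hadd : StrongConvexOn (Set.Icc (-b) b) mL
      (fun t : ℝ => ((L : ℝ) ^ d)⁻¹ * Real.log (W.partitionFunction ρ t).toReal) := by
    rw [strongConvexOn_real_iff] at hcgf ⊢
    refine (hcgf.add_const (((L : ℝ) ^ d)⁻¹ * Real.log (W.partitionFunction ρ 0).toReal)).congr fun t _ => ?_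
    simp only [Pi.add_apply, log_partitionFunction_eq_cgf_add ρ hρ.1 W t]
    ring
  exact hadd.mono hmono

/-- ★★ **EVERY THERMODYNAMIC LIMIT OF MEMBER FREE ENERGIES IS STRONGLY CONVEX, with the same modulus.**  Let `L_n ≥ k = max r 1 + 1` be
torus sides, `W_n ∈ ClusterDomainFR ε₀ ε₁ r` members on the torus of side `L_n`, and suppose the pressures `L_n^{−d} log Z_{Λ_{L_n},t,W_n}`
converge to `f t` for every `t ∈ [−b, b]`.  Then `StrongConvexOn [−b, b] ((2k)^{−d} e^{−(8(d−1)Nb + 2ε₀)} V₀) f`. [folklore] -/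
theorem strongConvexOn_of_tendsto_memberPressure (hρ : IsSpecialUnitaryModel ρ) (hN : 2 ≤ N) (hd : 2 ≤ d) {ε₀ ε₁ : ℝ} {r : ℕ}
    {Ls : ℕ → ℕ} [∀ n, NeZero (Ls n)] (hLs : ∀ n, max r 1 + 1 ≤ Ls n) {Ws : (n : ℕ) → Perturbation d (Ls n) N}
    (hWs : ∀ n, Ws n ∈ ClusterDomainFR ε₀ ε₁ r) {b : ℝ} {f : ℝ → ℝ}
    (hlim : ∀ t ∈ Set.Icc (-b) b,
      Tendsto (fun n => (((Ls n) : ℝ) ^ d)⁻¹ * Real.log ((Ws n).partitionFunction ρ t).toReal) atTop (𝓝 (f t))) :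
    StrongConvexOn (Set.Icc (-b) b)
      ((1 / (2 * (max r 1 + 1 : ℕ) : ℝ)) ^ d * Real.exp (-(8 * (d - 1 : ℕ) * N * b + 2 * ε₀)) * PlaquetteLowerBound.charVariance ρ)
      f := by
  set m : ℝ := (1 / (2 * (max r 1 + 1 : ℕ) : ℝ)) ^ d * Real.exp (-(8 * (d - 1 : ℕ) * N * b + 2 * ε₀)) *
    PlaquetteLowerBound.charVariance ρ with hm
  rw [strongConvexOn_real_iff]
  refine convexOn_of_tendsto (convex_Icc _ _)
    (p := fun n t => (((Ls n) : ℝ) ^ d)⁻¹ * Real.log ((Ws n).partitionFunction ρ t).toReal - m / 2 * t ^ 2)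
    (Filter.Eventually.of_forall fun n => ?_) fun t ht => (hlim t ht).sub_const _
  have h := strongConvexOn_memberPressure ρ hρ hN hd (hWs n) (hLs n) b
  rw [strongConvexOn_real_iff] at h
  exact h

/-- ★★ **`SU(2)`, `d = 4`** (tree coupling `β = β_W/2`, `V₀ = 1`): for every `L ≥ k = max r 1 + 1`, every member `W ∈ ClusterDomainFR ε₀ ε₁ r`
of the tier-1 torus ball and every `b`, the pressure `t ↦ L^{−4} log Z_{Λ_L,t,W}` is strongly convex on `[−b, b]` with modulus
`e^{−(48 b + 2ε₀)} / (2k)^4`. [folklore] -/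
theorem su2_strongConvexOn_memberPressure_dim4 {L : ℕ} [NeZero L] {ε₀ ε₁ : ℝ} {r : ℕ} {W : Perturbation 4 L 2}
    (hW : W ∈ ClusterDomainFR ε₀ ε₁ r) (hL : max r 1 + 1 ≤ L) (b : ℝ) :
    StrongConvexOn (Set.Icc (-b) b) (Real.exp (-(48 * b + 2 * ε₀)) / (2 * (max r 1 + 1 : ℕ) : ℝ) ^ 4)
      (fun t : ℝ => ((L : ℝ) ^ 4)⁻¹ * Real.log (W.partitionFunction (fundamentalRep (Fin 2)) t).toReal) := by
  have h := strongConvexOn_memberPressure (d := 4) (fundamentalRep (Fin 2)) (TorusAreaLaw.isSpecialUnitaryModel_fundamentalRep 2)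
    le_rfl (by norm_num) hW hL b
  rw [HaarSecondMoments.charVariance_su2, mul_one] at h
  have e : (1 / (2 * (max r 1 + 1 : ℕ) : ℝ)) ^ 4 * Real.exp (-(8 * (4 - 1 : ℕ) * (2 : ℕ) * b + 2 * ε₀)) =
      Real.exp (-(48 * b + 2 * ε₀)) / (2 * (max r 1 + 1 : ℕ) : ℝ) ^ 4 := by
    rw [div_pow, one_pow]
    norm_num
    ring_nf
  rw [e] at h
  exact h

/-- ★★ **Every `SU(N)`, `N ≥ 3`, every `d ≥ 2`** (`V₀ = 1/2`): for every `L ≥ k`, every member `W ∈ ClusterDomainFR ε₀ ε₁ r` and every `b`, the member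
pressure is strongly convex on `[−b, b]` with modulus `(1/2) e^{−(8(d−1)Nb + 2ε₀)}/(2k)^d`. [folklore] -/
theorem suN_strongConvexOn_memberPressure {N : ℕ} (hN : 3 ≤ N) (hd : 2 ≤ d) {ε₀ ε₁ : ℝ} {r : ℕ} {W : Perturbation d L N}
    (hW : W ∈ ClusterDomainFR ε₀ ε₁ r) (hL : max r 1 + 1 ≤ L) (b : ℝ) :
    StrongConvexOn (Set.Icc (-b) b)
      ((1 / (2 * (max r 1 + 1 : ℕ) : ℝ)) ^ d * Real.exp (-(8 * (d - 1 : ℕ) * N * b + 2 * ε₀)) * (1 / 2))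
      (fun t : ℝ => ((L : ℝ) ^ d)⁻¹ * Real.log (W.partitionFunction (fundamentalRep (Fin N)) t).toReal) := by
  have h := strongConvexOn_memberPressure (fundamentalRep (Fin N)) (TorusAreaLaw.isSpecialUnitaryModel_fundamentalRep N) (by omega) hd hW hL b
  rw [HaarSecondMoments.charVariance_suN hN] at h
  exact h

end Floor

end EnergyVariance

end Summit.Ventures.YMGap.RobustBall
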